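import Literature.Probability.RandomPlanarGeometry.SLEKappaRhoLogDeriv
import HarnessLib

/-!
# The SLE(κ, ρ) correction for `ρ > 0`: `ρ ∫₀ᵗ J (φ(X) - φ(Y)) ≥ -(ρ/2) log(x/y)`, via `log(g_t(x) - O_t)`

Second stochastic step of the Koebe/log-derivative route to the named fact
`Literature.Probability.RandomPlanarGeometry.SLEKappaRho.ae_forall_ofReal_notMem_closure_hullUnion`
(`SLEKappaRhoFillVersion`), completing `SLEKappaRhoLogDeriv` (which treats `ρ ≤ 0`), after

* G. F. Lawler, O. Schramm, W. Werner, *Conformal restriction: the chordal case*, J. Amer. Math.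
  Soc. **16** (2003), §8.3–8.5: for SLE(κ, ρ), `O_t = -2 ∫₀ᵗ du/Z_u` is the flow of the force
  point, `d(g_t(x) - O_t) = (2/(g_t(x) - W_t) + 2/Z_t) dt` and the natural coordinates are
  `G_t = (g_t(x) - O_t)/(W_t - O_t)` (§8.5, p. 40);
* S. Rohde, O. Schramm, *Basic properties of SLE*, Ann. of Math. **161** (2005), proof of
  Lemma 7.2 (p. 909).

For the exact SLE(κ, ρ) analogue of Rohde–Schramm's martingale one corrects `log X_t` by
`(ρ/2) log U_t`, `U_t = g_t(x) - O_t = X_t + Z_t`: since `U̇ = 2/X + 2/Z`,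
`d log U = 2 dt/(X Z)`, which cancels the SLE(κ, ρ) drift `-ρ dt/(X Z)` of `log X`. We only need the
resulting one-sided BOUND on the correction functional `logCutCorr` of `SLEKappaRhoLogDeriv`:

* `SLEKappaRho.uProc W' J z = flowReg W' z + (W' + 2 ∫₀ J)` — the process `U = X + Z'` (adapted);
  a.s., on `{T_z = ∞}`, `U_t = z + ∫₀ᵗ (2/X_s + 2 J_s) ds ≥ z` (`RegularPair.ae_uProc_eq_integral`),
  an Itô process with ZERO diffusion coefficient, so that the tree's Itô formula gives the chain
  rule **`log U_t = log z + ∫₀ᵗ (2/X_s + 2 J_s)/U_s ds`** a.s. (`RegularPair.ae_log_uProc_eq`,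
  with `f = logCut z = log` on `[z, ∞) ∋ U`);
* the pointwise inequality `2 J (1/Y - 1/X) ≤ (2/Y + 2J)/(Y + Z') - (2/X + 2J)/(X + Z')`
  (`J = 1/Z'`; equality when `Z' > 0`) integrates, for `0 < y ≤ x` never swallowed, to
  **`∫₀ᵗ J_s (1/Y_s - 1/X_s) ds ≤ ½ (log x - log y)`** a.s. (`RegularPair.ae_integral_J_sub_inv_le`:
  the right-hand side is `log(U^y_t/y) - log(U^x_t/x) ≤ log(x/y)` as `U^x - U^y = X - Y ≥ 0`);
* since `v ↦ logCutD δ v - 1/v` is non-decreasing on `(0, ∞)` (`monotoneOn_logCutD_sub_inv`),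
  `φ(X) - φ(Y) ≥ 1/X - 1/Y`, whence for `ρ ≥ 0`:
  **a.s. `logCutCorr ρ δ ≥ -(ρ/2)(log x - log y)` at all times and levels**
  (`RegularPair.ae_logCutCorr_ge_of_nonneg`), and the a.s. bound on `log |g_t'(x)| - log |g_t'(y)|`
  for ALL `ρ` (`RegularPair.ae_exists_forall_log_deriv_sub_le_all`).

No named fact is introduced.
-/

noncomputable section

open Set Filter Topology MeasureTheory
open scoped NNReal ENNReal
open Literature.Analysis.FunctionSpaces Literature.Probability.Process

namespace Literature.Probability.RandomPlanarGeometry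

namespace SLEKappaRho

/-! ### `logCutD δ - 1/v` is non-decreasing on `(0, ∞)` -/

/-- **`v ↦ logCutD δ v - v⁻¹` is non-decreasing on `(0, ∞)`** (`δ > 0`): it is
`(2δ - v)/δ² - 1/v` on `(0, δ]` (derivative `1/v² - 1/δ² ≥ 0`) and `0` on `[δ, ∞)`. Hence
`logCutD δ X - logCutD δ Y ≥ X⁻¹ - Y⁻¹` for `0 < Y ≤ X`. [folklore] -/
theorem monotoneOn_logCutD_sub_inv {δ : ℝ} (hδ : 0 < δ) :
    MonotoneOn (fun v ↦ logCutD δ v - v⁻¹) (Ioi 0) := by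
  have hlow : ∀ a b : ℝ, 0 < a → a ≤ b → b ≤ δ →
      logCutD δ a - a⁻¹ ≤ logCutD δ b - b⁻¹ := by
    intro a b ha hab hbδ
    have hb : 0 < b := ha.trans_le hab
    rw [logCutD_of_ge hδ (hab.trans hbδ), logCutD_of_ge hδ hbδ]
    have habδ : a * b ≤ δ ^ 2 := by nlinarith
    rw [← sub_nonneg]
    have : (2 * δ - b) / δ ^ 2 - b⁻¹ - ((2 * δ - a) / δ ^ 2 - a⁻¹) =
        (b - a) * (δ ^ 2 - a * b) / (a * b * δ ^ 2) := by
      field_simp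
      ring
    rw [this]
    exact div_nonneg (mul_nonneg (sub_nonneg.2 hab) (sub_nonneg.2 habδ)) (by positivity)
  have hup : ∀ v : ℝ, δ ≤ v → logCutD δ v - v⁻¹ = 0 := fun v hv ↦ by
    rw [logCutD_of_le hδ hv, sub_self]
  intro a ha b _ hab
  simp only
  rcases le_total b δ with hbδ | hδb
  · exact hlow a b ha hab hbδ
  · rw [hup b hδb]
    rcases le_total a δ with haδ | hδa
    · rw [← hup δ le_rfl]
      exact hlow a δ ha haδ le_rfl
    · rw [hup a hδa]

/-! ### The process `U = X + Z'` and the chain rule for `log U` -/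

/-- **The process `U = g(z) - O' = X + Z'`** of a regular version: the clamped progressive flow
from `z` plus `Z' = W' + 2 ∫₀ J`. [cite: LawlerSchrammWerner2003Restriction, §8.5 (p. 40: G_t = (g_t(z) − O_t)/(W_t − O_t))] -/
def uProc (W' J : ℝ≥0 → (ℝ≥0 → ℝ) → ℝ) (z : ℝ) : ℝ≥0 → (ℝ≥0 → ℝ) → ℝ :=
  fun t ω ↦ flowReg W' z t ω + (W' t ω + 2 * timeIntegral J t ω)

namespace RegularPair

variable {κ : ℝ≥0} {ρ : ℝ} {W W' J : ℝ≥0 → (ℝ≥0 → ℝ) → ℝ} {x y z : ℝ}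

/-- `U` is adapted (`z > 0`). [folklore] -/
theorem adapted_uProc (h : RegularPair κ ρ W W' J) (hz : 0 < z) : Adapted brownianFiltration (uProc W' J z) :=
  fun t ↦ ((h.stronglyAdapted_flowReg hz t).measurable).add
    ((h.adapted t).add ((adapted_timeIntegral h.progressive t).const_mul _))

/-- `U_0 = z` (every sample). [folklore] -/
theorem uProc_zero (h : RegularPair κ ρ W W' J) (hz : 0 < z) (ω : ℝ≥0 → ℝ) : uProc W' J z 0 ω = z := by
  simp [uProc, h.flowReg_zero hz, h.apply_zero, timeIntegral_apply_zero]

/-- **The integrated equation of `U`**: a.s., for every `z > 0` never swallowed, for all `t`,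
`U_t = z + ∫₀ᵗ (2/X_s + 2 J_s) ds` (so `U_t ≥ z`), both summands of the integrand being integrable
on `[0, t]` and the path of `U` continuous (`X_t = z + ∫ (2/X - ρ J) - √κ B`,
`W'_t = √κ B_t + ρ ∫ J`). [cite: LawlerSchrammWerner2003Restriction, §8.3–8.5 (U̇ = 2/X + 2/Z)] -/
theorem ae_uProc_eq_integral (h : RegularPair κ ρ W W' J) :
    ∀ᵐ ω ∂preWienerMeasure, ∀ z : ℝ, 0 < z → Loewner.swallowingTime (fun s ↦ W s ω) z = ⊤ →
      (∀ t : ℝ≥0, IntervalIntegrable (fun s : ℝ ↦ 2 / flowReg W' z s.toNNReal ω) volume 0 t) ∧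
      (∀ t : ℝ≥0, IntervalIntegrable (fun s : ℝ ↦ J s.toNNReal ω) volume 0 t) ∧
      (∀ t, 0 < flowReg W' z t ω) ∧
      (Continuous fun t ↦ uProc W' J z t ω) ∧
      ∀ t : ℝ≥0, uProc W' J z t ω =
        z + ∫ s in (0 : ℝ)..t, (2 / flowReg W' z s.toNNReal ω + 2 * J s.toNNReal ω) := by
  filter_upwards [h.ae_continuous, h.ae_flowProc_eq_integral, h.ae_eq_brownian] with ω hc hint hB z hz hT
  have hz0 : W' 0 ω < z := by rw [h.apply_zero]; exact hz
  obtain ⟨hcont, hpos, h2, hJ, heq⟩ := hint z hz hT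
  have hreg : ∀ t, flowReg W' z t ω = Loewner.flowProc W' z t ω := fun t ↦ flowReg_eq_of_continuous hc hz0 t
  have h2' : ∀ t : ℝ≥0, IntervalIntegrable (fun s : ℝ ↦ 2 / flowReg W' z s.toNNReal ω) volume 0 t := by
    intro t
    have : (fun s : ℝ ↦ 2 / flowReg W' z s.toNNReal ω) = fun s ↦ 2 / Loewner.flowProc W' z s.toNNReal ω := by
      funext s; rw [hreg]
    rw [this]; exact h2 t
  have hIcont : Continuous fun t : ℝ≥0 ↦ timeIntegral J t ω := by
    refine continuous_timeIntegral fun t ↦ ?_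
    exact Iff.mpr integrableOn_Icc_iff_integrableOn_Ioc
      ((intervalIntegrable_iff_integrableOn_Ioc_of_le t.coe_nonneg).1 (hJ t))
  refine ⟨h2', hJ, fun t ↦ by rw [hreg]; exact hpos t, ?_, fun t ↦ ?_⟩
  · have hregc : Continuous fun t ↦ flowReg W' z t ω := by
      have : (fun t ↦ flowReg W' z t ω) = fun t ↦ Loewner.flowProc W' z t ω := funext hreg
      rw [this]; exact hcont
    exact hregc.add (hc.add (continuous_const.mul hIcont))
  · rw [uProc, hreg t, heq t, hB t, intervalIntegral.integral_add (h2' t) ((hJ t).const_mul 2),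
      intervalIntegral.integral_sub (h2 t) ((hJ t).const_mul ρ), intervalIntegral.integral_const_mul,
      intervalIntegral.integral_const_mul]
    have : (∫ s in (0 : ℝ)..t, 2 / flowReg W' z s.toNNReal ω) =
        ∫ s in (0 : ℝ)..t, 2 / Loewner.flowProc W' z s.toNNReal ω := by
      refine intervalIntegral.integral_congr fun s _ ↦ ?_
      simp only [hreg]
    rw [this, timeIntegral]
    ring

/-- **`U` is an Itô process with zero diffusion coefficient**: `U_t = z + ∫₀ᵗ (2/X_s + 2 J_s) ds`,
for `z > 0` a.s. never swallowed. [folklore] -/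
theorem isItoProcess_uProc (h : RegularPair κ ρ W W' J) (hz : 0 < z)
    (hT : ∀ᵐ ω ∂preWienerMeasure, Loewner.swallowingTime (fun s ↦ W s ω) z = ⊤) :
    IsItoProcess (uProc W' J z) (fun s ω ↦ 2 / flowReg W' z s ω + 2 * J s ω) (fun _ _ ↦ 0)
      brownian brownianFiltration preWienerMeasure := by
  refine ⟨?_, fun t ω ↦ 0 * brownian t ω, isItoIntegral_const_brownian 0, ?_⟩
  · filter_upwards [h.ae_uProc_eq_integral, hT] with ω hω hTω t
    obtain ⟨h2, hJ, -, -, -⟩ := hω z hz hTω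
    have hii : IntervalIntegrable (fun s : ℝ ↦ 2 / flowReg W' z s.toNNReal ω + 2 * J s.toNNReal ω)
        volume 0 t := (h2 t).add ((hJ t).const_mul 2)
    exact Iff.mpr integrableOn_Icc_iff_integrableOn_Ioc
      ((intervalIntegrable_iff_integrableOn_Ioc_of_le t.coe_nonneg).1 hii)
  · filter_upwards [h.ae_uProc_eq_integral, hT] with ω hω hTω t
    obtain ⟨-, -, -, -, heq⟩ := hω z hz hTω
    rw [heq t, h.uProc_zero hz]
    ring

/-- **The chain rule `log U_t = log z + ∫₀ᵗ (2/X_s + 2 J_s)/U_s ds`**, a.s. for all `t`, for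
`z > 0` a.s. never swallowed: the tree's Itô formula (`ito_formula_itoProcess_ae_holds`) for the
Itô process `U` with zero diffusion coefficient and the `C²` function `logCut z`, which is `log`
with derivative `1/v` on `[z, ∞) ∋ U_s`. [cite: RevuzYor1999, Ch. IV Thm (3.3) and Remark 1] -/
theorem ae_log_uProc_eq (h : RegularPair κ ρ W W' J) (hz : 0 < z)
    (hT : ∀ᵐ ω ∂preWienerMeasure, Loewner.swallowingTime (fun s ↦ W s ω) z = ⊤) :
    ∀ᵐ ω ∂preWienerMeasure, ∀ t : ℝ≥0, Real.log (uProc W' J z t ω) =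
      Real.log z + ∫ s in (0 : ℝ)..t,
        (2 / flowReg W' z s.toNNReal ω + 2 * J s.toNNReal ω) / uProc W' J z s.toNNReal ω := by
  have hf : ContDiff ℝ 2 (Function.uncurry fun (_ : ℝ) (v : ℝ) ↦ logCut z v) :=
    (contDiff_logCut hz).comp contDiff_snd
  have hK : IsItoIntegral (fun t ω ↦ (fun (_ : ℝ≥0) (_ : ℝ≥0 → ℝ) ↦ (0 : ℝ)) t ω *
      deriv ((fun (_ : ℝ) (v : ℝ) ↦ logCut z v) t) (uProc W' J z t ω)) brownian
      (fun t ω ↦ 0 * brownian t ω) brownianFiltration preWienerMeasure := by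
    have hH : (fun t ω ↦ (fun (_ : ℝ≥0) (_ : ℝ≥0 → ℝ) ↦ (0 : ℝ)) t ω *
        deriv ((fun (_ : ℝ) (v : ℝ) ↦ logCut z v) t) (uProc W' J z t ω)) =
        fun (_ : ℝ≥0) (_ : ℝ≥0 → ℝ) ↦ (0 : ℝ) := by
      funext t ω
      exact zero_mul _
    rw [hH]
    exact isItoIntegral_const_brownian 0
  have hito := ito_formula_itoProcess_ae_holds (fun (_ : ℝ) (v : ℝ) ↦ logCut z v) hf
    (h.adapted_uProc hz) (isStronglyProgressive_const _ _) (h.isItoProcess_uProc hz hT) hK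
  filter_upwards [hito, h.ae_uProc_eq_integral, hT] with ω hω hU hTω t
  obtain ⟨h2, hJ, hpos, -, heq⟩ := hU z hz hTω
  -- `U_s ≥ z`
  have hge : ∀ s : ℝ≥0, z ≤ uProc W' J z s ω := by
    intro s
    rw [heq s]
    have : 0 ≤ ∫ r in (0 : ℝ)..s, (2 / flowReg W' z r.toNNReal ω + 2 * J r.toNNReal ω) :=
      intervalIntegral.integral_nonneg s.coe_nonneg fun r _ ↦
        add_nonneg (div_nonneg zero_le_two (hpos _).le) (mul_nonneg zero_le_two (h.nonneg _ _))
    linarith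
  have h1 := hω t
  simp only [deriv_const, zero_add, h.uProc_zero hz, zero_mul, zero_pow two_ne_zero,
    mul_zero, add_zero] at h1
  rw [logCut_of_le hz (hge t), logCut_of_le hz le_rfl] at h1
  rw [h1]
  congr 1
  refine intervalIntegral.integral_congr fun s _ ↦ ?_
  show _ * deriv (logCut z) _ = _
  rw [deriv_logCut hz, logCutD_of_le hz (hge _)]
  ring

/-! ### `∫₀ᵗ J (1/Y - 1/X) ≤ ½ log(x/y)` -/

/-- The pointwise inequality behind the bound: for `0 < Y ≤ X`, `Z' ≥ 0` and `J = 1/Z'`,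
`2 J (1/Y - 1/X) ≤ (2/Y + 2J)/(Y + Z') - (2/X + 2J)/(X + Z')` (equality for `Z' > 0`; for
`Z' = 0` the left side vanishes and the right side is `2/Y² - 2/X² ≥ 0`). [folklore] -/
theorem two_mul_inv_sub_le {X Y Z : ℝ} (hY : 0 < Y) (hYX : Y ≤ X) (hZ : 0 ≤ Z) :
    2 * Z⁻¹ * (Y⁻¹ - X⁻¹) ≤ (2 / Y + 2 * Z⁻¹) / (Y + Z) - (2 / X + 2 * Z⁻¹) / (X + Z) := by
  have hX : 0 < X := hY.trans_le hYX
  rcases hZ.eq_or_lt with hZ0 | hZpos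
  · rw [← hZ0]
    simp only [inv_zero, mul_zero, zero_mul, add_zero]
    rw [div_div, div_div]
    have h1 : 2 / (X * X) ≤ 2 / (Y * Y) :=
      div_le_div_of_nonneg_left zero_le_two (mul_pos hY hY) (mul_le_mul hYX hYX hY.le hX.le)
    linarith
  · have hYZ : 0 < Y + Z := by linarith
    have hXZ : 0 < X + Z := by linarith
    rw [← sub_nonneg]
    have : (2 / Y + 2 * Z⁻¹) / (Y + Z) - (2 / X + 2 * Z⁻¹) / (X + Z) - 2 * Z⁻¹ * (Y⁻¹ - X⁻¹) = 0 := by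
      field_simp
      ring
    rw [this]

/-- **`∫₀ᵗ J_s (1/Y_s - 1/X_s) ds ≤ ½ (log x - log y)`**, a.s. for all `t`, for `0 < y ≤ x` a.s.
never swallowed: integrate `two_mul_inv_sub_le` (`U^y = Y + Z'`, `U^x = X + Z'`) and use the chain
rules `∫₀ᵗ (2/Y + 2J)/U^y = log(U^y_t/y)`, `∫₀ᵗ (2/X + 2J)/U^x = log(U^x_t/x)` together with
`U^x_t ≥ U^y_t` (`U^x - U^y = X - Y ≥ 0`). [cite: LawlerSchrammWerner2003Restriction, §8.4–8.5 (pp. 38–40)] -/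
theorem ae_integral_J_sub_inv_le (h : RegularPair κ ρ W W' J) (hy : 0 < y) (hyx : y ≤ x)
    (hTx : ∀ᵐ ω ∂preWienerMeasure, Loewner.swallowingTime (fun s ↦ W s ω) x = ⊤)
    (hTy : ∀ᵐ ω ∂preWienerMeasure, Loewner.swallowingTime (fun s ↦ W s ω) y = ⊤) :
    ∀ᵐ ω ∂preWienerMeasure, ∀ t : ℝ≥0,
      ∫ s in (0 : ℝ)..t, J s.toNNReal ω *
          ((Loewner.realFlowStop (fun r ↦ W r ω) y s.toNNReal)⁻¹ -
            (Loewner.realFlowStop (fun r ↦ W r ω) x s.toNNReal)⁻¹) ≤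
        (Real.log x - Real.log y) / 2 := by
  have hx : 0 < x := hy.trans_le hyx
  filter_upwards [h.ae_log_uProc_eq hx hTx, h.ae_log_uProc_eq hy hTy, h.ae_uProc_eq_integral, hTx, hTy,
    h.ae_good hy hx hTy] with ω hlogx hlogy hU hTxω hTyω ⟨hc, hW0, hT, hX, hY, hJ⟩ t
  obtain ⟨h2x, -, hposx, hUxc, hUx⟩ := hU x hx hTxω
  obtain ⟨h2y, -, hposy, hUyc, hUy⟩ := hU y hy hTyω
  set Xf : ℝ≥0 → ℝ := Loewner.realFlowStop (fun r ↦ W r ω) x with hXf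
  set Yf : ℝ≥0 → ℝ := Loewner.realFlowStop (fun r ↦ W r ω) y with hYf
  have hflows : ∀ s : ℝ≥0, 0 < Yf s ∧ Yf s ≤ Xf s := realFlowStop_pos_and_le hc hW0 hy hyx hT
  set Zf : ℝ≥0 → ℝ := fun s ↦ W' s ω + 2 * timeIntegral J s ω with hZf
  have hZnn : ∀ s, 0 ≤ Zf s := fun s ↦ h.add_nonneg' s ω
  have hJZ : ∀ s, J s ω = (Zf s)⁻¹ := fun s ↦ h.eq_inv s ω
  have hUxs : ∀ s, uProc W' J x s ω = Xf s + Zf s := fun s ↦ by simp only [uProc, hX s, hXf, hZf]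
  have hUys : ∀ s, uProc W' J y s ω = Yf s + Zf s := fun s ↦ by simp only [uProc, hY s, hYf, hZf]
  -- `U ≥ start`, hence positive
  have hUyge : ∀ s : ℝ≥0, y ≤ uProc W' J y s ω := by
    intro s
    rw [hUy s]
    have : 0 ≤ ∫ r in (0 : ℝ)..s, (2 / flowReg W' y r.toNNReal ω + 2 * J r.toNNReal ω) :=
      intervalIntegral.integral_nonneg s.coe_nonneg fun r _ ↦
        add_nonneg (div_nonneg zero_le_two (hposy _).le) (mul_nonneg zero_le_two (h.nonneg _ _))
    linarith
  have hUxge : ∀ s : ℝ≥0, x ≤ uProc W' J x s ω := by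
    intro s
    rw [hUx s]
    have : 0 ≤ ∫ r in (0 : ℝ)..s, (2 / flowReg W' x r.toNNReal ω + 2 * J r.toNNReal ω) :=
      intervalIntegral.integral_nonneg s.coe_nonneg fun r _ ↦
        add_nonneg (div_nonneg zero_le_two (hposx _).le) (mul_nonneg zero_le_two (h.nonneg _ _))
    linarith
  -- pointwise inequality
  have hpt : ∀ s : ℝ, J s.toNNReal ω * ((Yf s.toNNReal)⁻¹ - (Xf s.toNNReal)⁻¹) ≤
      ((2 / flowReg W' y s.toNNReal ω + 2 * J s.toNNReal ω) / uProc W' J y s.toNNReal ω -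
        (2 / flowReg W' x s.toNNReal ω + 2 * J s.toNNReal ω) / uProc W' J x s.toNNReal ω) / 2 := by
    intro s
    have h1 := two_mul_inv_sub_le (hflows s.toNNReal).1 (hflows s.toNNReal).2 (hZnn s.toNNReal)
    rw [hX, hY, hUxs, hUys, hJZ]
    simp only [hXf, hYf] at h1 ⊢
    linarith
  -- integrability
  have hXc' : Continuous fun s : ℝ ↦ Xf s.toNNReal :=
    (Loewner.continuous_realFlowStop hc (show (fun r ↦ W r ω) 0 < x by simp only [hW0]; exact hx)).comp
      continuous_real_toNNReal
  have hYc' : Continuous fun s : ℝ ↦ Yf s.toNNReal :=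
    (Loewner.continuous_realFlowStop hc (show (fun r ↦ W r ω) 0 < y by simp only [hW0]; exact hy)).comp
      continuous_real_toNNReal
  have hinvc : Continuous fun s : ℝ ↦ (Yf s.toNNReal)⁻¹ - (Xf s.toNNReal)⁻¹ :=
    (hYc'.inv₀ fun s ↦ (hflows _).1.ne').sub (hXc'.inv₀ fun s ↦ ((hflows _).1.trans_le (hflows _).2).ne')
  have hIl : IntervalIntegrable (fun s : ℝ ↦ J s.toNNReal ω * ((Yf s.toNNReal)⁻¹ - (Xf s.toNNReal)⁻¹))
      volume 0 t := (hJ t).mul_continuousOn hinvc.continuousOn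
  have hUyc' : Continuous fun s : ℝ ↦ (uProc W' J y s.toNNReal ω)⁻¹ :=
    (hUyc.comp continuous_real_toNNReal).inv₀ fun s ↦ (hy.trans_le (hUyge _)).ne'
  have hUxc' : Continuous fun s : ℝ ↦ (uProc W' J x s.toNNReal ω)⁻¹ :=
    (hUxc.comp continuous_real_toNNReal).inv₀ fun s ↦ (hx.trans_le (hUxge _)).ne'
  have hIy : IntervalIntegrable (fun s : ℝ ↦ (2 / flowReg W' y s.toNNReal ω + 2 * J s.toNNReal ω) /
      uProc W' J y s.toNNReal ω) volume 0 t := by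
    simp only [div_eq_mul_inv]
    exact ((h2y t).add ((hJ t).const_mul 2)).mul_continuousOn hUyc'.continuousOn
  have hIx : IntervalIntegrable (fun s : ℝ ↦ (2 / flowReg W' x s.toNNReal ω + 2 * J s.toNNReal ω) /
      uProc W' J x s.toNNReal ω) volume 0 t := by
    simp only [div_eq_mul_inv]
    exact ((h2x t).add ((hJ t).const_mul 2)).mul_continuousOn hUxc'.continuousOn
  -- integrate
  have hint_le := intervalIntegral.integral_mono_on t.coe_nonneg hIl ((hIy.sub hIx).div_const 2)
    fun s _ ↦ hpt s
  refine hint_le.trans ?_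
  rw [intervalIntegral.integral_div, intervalIntegral.integral_sub hIy hIx]
  have hlx := hlogx t
  have hly := hlogy t
  refine div_le_div_of_nonneg_right ?_ zero_le_two
  -- `log U^y_t - log y - (log U^x_t - log x) ≤ log x - log y`
  have hUle : uProc W' J y t ω ≤ uProc W' J x t ω := by
    rw [hUys, hUxs]
    linarith [(hflows t).2]
  have hlogle : Real.log (uProc W' J y t ω) ≤ Real.log (uProc W' J x t ω) :=
    Real.log_le_log (hy.trans_le (hUyge t)) hUle
  linarith

/-! ### The correction bound for `ρ ≥ 0` and the a.s. bound for all `ρ` -/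

/-- **For `ρ ≥ 0`, a.s. `logCutCorr ρ δ ≥ -(ρ/2)(log x - log y)` at all times**, for every level
`δ > 0` and `0 < y ≤ x` a.s. never swallowed: `φ(X) - φ(Y) ≥ 1/X - 1/Y`
(`monotoneOn_logCutD_sub_inv`), `J ≥ 0`, and `∫₀ᵗ J (1/Y - 1/X) ≤ ½ log(x/y)`
(`ae_integral_J_sub_inv_le`). [cite: LawlerSchrammWerner2003Restriction, §8.4 (p. 38)] -/
theorem ae_logCutCorr_ge_of_nonneg (h : RegularPair κ ρ W W' J) (hρ : 0 ≤ ρ) (hy : 0 < y) (hyx : y ≤ x)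
    (hTx : ∀ᵐ ω ∂preWienerMeasure, Loewner.swallowingTime (fun s ↦ W s ω) x = ⊤)
    (hTy : ∀ᵐ ω ∂preWienerMeasure, Loewner.swallowingTime (fun s ↦ W s ω) y = ⊤) {δ : ℝ} (hδ : 0 < δ) :
    ∀ᵐ ω ∂preWienerMeasure, ∀ t, -(ρ / 2 * (Real.log x - Real.log y)) ≤ logCutCorr ρ δ W J x y t ω := by
  have hx : 0 < x := hy.trans_le hyx
  filter_upwards [h.ae_integral_J_sub_inv_le hy hyx hTx hTy, h.ae_good hy hx hTy]
    with ω hΔ ⟨hc, hW0, hT, _, _, hJ⟩ t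
  set Xf : ℝ≥0 → ℝ := Loewner.realFlowStop (fun r ↦ W r ω) x with hXf
  set Yf : ℝ≥0 → ℝ := Loewner.realFlowStop (fun r ↦ W r ω) y with hYf
  have hflows : ∀ s : ℝ≥0, 0 < Yf s ∧ Yf s ≤ Xf s := realFlowStop_pos_and_le hc hW0 hy hyx hT
  -- pointwise: `ρ J (φX - φY) ≥ -ρ J (1/Y - 1/X)`
  have hpt : ∀ s : ℝ, -(ρ * (J s.toNNReal ω * ((Yf s.toNNReal)⁻¹ - (Xf s.toNNReal)⁻¹))) ≤
      ρ * (J s.toNNReal ω * (logCutD δ (Xf s.toNNReal) - logCutD δ (Yf s.toNNReal))) := by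
    intro s
    have hm := monotoneOn_logCutD_sub_inv hδ (hflows s.toNNReal).1
      ((hflows s.toNNReal).1.trans_le (hflows s.toNNReal).2) (hflows s.toNNReal).2
    simp only at hm
    have h1 : (Xf s.toNNReal)⁻¹ - (Yf s.toNNReal)⁻¹ ≤ logCutD δ (Xf s.toNNReal) - logCutD δ (Yf s.toNNReal) := by
      linarith
    have h2 := mul_le_mul_of_nonneg_left h1 (h.nonneg s.toNNReal ω)
    have h3 := mul_le_mul_of_nonneg_left h2 hρ
    linarith
  -- integrability
  have hXc' : Continuous fun s : ℝ ↦ Xf s.toNNReal :=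
    (Loewner.continuous_realFlowStop hc (show (fun r ↦ W r ω) 0 < x by simp only [hW0]; exact hx)).comp
      continuous_real_toNNReal
  have hYc' : Continuous fun s : ℝ ↦ Yf s.toNNReal :=
    (Loewner.continuous_realFlowStop hc (show (fun r ↦ W r ω) 0 < y by simp only [hW0]; exact hy)).comp
      continuous_real_toNNReal
  have hinvc : Continuous fun s : ℝ ↦ (Yf s.toNNReal)⁻¹ - (Xf s.toNNReal)⁻¹ :=
    (hYc'.inv₀ fun s ↦ (hflows _).1.ne').sub (hXc'.inv₀ fun s ↦ ((hflows _).1.trans_le (hflows _).2).ne')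
  have hφc : Continuous fun s : ℝ ↦ logCutD δ (Xf s.toNNReal) - logCutD δ (Yf s.toNNReal) :=
    ((continuous_logCutD hδ).comp hXc').sub ((continuous_logCutD hδ).comp hYc')
  have hIl : IntervalIntegrable (fun s : ℝ ↦ -(ρ * (J s.toNNReal ω * ((Yf s.toNNReal)⁻¹ - (Xf s.toNNReal)⁻¹))))
      volume 0 t := (((hJ t).mul_continuousOn hinvc.continuousOn).const_mul ρ).neg
  have hIr : IntervalIntegrable (fun s : ℝ ↦ ρ * (J s.toNNReal ω *
      (logCutD δ (Xf s.toNNReal) - logCutD δ (Yf s.toNNReal)))) volume 0 t :=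
    ((hJ t).mul_continuousOn hφc.continuousOn).const_mul ρ
  have hmono := intervalIntegral.integral_mono_on t.coe_nonneg hIl hIr fun s _ ↦ hpt s
  rw [intervalIntegral.integral_neg, intervalIntegral.integral_const_mul] at hmono
  have hΔt := hΔ t
  have hρΔ := mul_le_mul_of_nonneg_left hΔt hρ
  show -(ρ / 2 * (Real.log x - Real.log y)) ≤ ∫ s in (0 : ℝ)..t, ρ * (J s.toNNReal ω *
      (logCutD δ (Xf s.toNNReal) - logCutD δ (Yf s.toNNReal)))
  refine le_trans ?_ hmono
  rw [neg_le_neg_iff]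
  calc ρ * ∫ s in (0 : ℝ)..t, J s.toNNReal ω * ((Yf s.toNNReal)⁻¹ - (Xf s.toNNReal)⁻¹)
      ≤ ρ * ((Real.log x - Real.log y) / 2) := hρΔ
    _ = ρ / 2 * (Real.log x - Real.log y) := by ring

/-- **For `κ < 4`, ANY `ρ`, and `0 < y ≤ x` a.s. never swallowed, almost surely
`sup_t (log |g_t'(x)| - log |g_t'(y)|) < ∞`** (`ae_exists_forall_log_deriv_sub_le` of
`SLEKappaRhoLogDeriv` with `K = 0` for `ρ ≤ 0` and `K = (ρ/2) log(x/y)` for `ρ ≥ 0`).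
[cite: RohdeSchramm2005, proof of Lemma 7.2 (p. 909)] -/
theorem ae_exists_forall_log_deriv_sub_le_all (h : RegularPair κ ρ W W' J) (hκ : κ < 4) (hy : 0 < y)
    (hyx : y ≤ x) (hTx : ∀ᵐ ω ∂preWienerMeasure, Loewner.swallowingTime (fun s ↦ W s ω) x = ⊤)
    (hTy : ∀ᵐ ω ∂preWienerMeasure, Loewner.swallowingTime (fun s ↦ W s ω) y = ⊤) :
    ∀ᵐ ω ∂preWienerMeasure, ∃ L : ℝ, ∀ t : ℝ≥0,
      Real.log ‖deriv (Loewner.map (fun s ↦ W s ω) t) x‖ -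
        Real.log ‖deriv (Loewner.map (fun s ↦ W s ω) t) y‖ ≤ L := by
  rcases le_or_gt ρ 0 with hρ | hρ
  · exact h.ae_exists_forall_log_deriv_sub_le_of_nonpos hκ hρ hy hyx hTx hTy
  · exact h.ae_exists_forall_log_deriv_sub_le hκ hy hyx hTx hTy
      fun _ hδ _ ↦ h.ae_logCutCorr_ge_of_nonneg hρ.le hy hyx hTx hTy hδ

end RegularPair

end SLEKappaRho

end Literature.Probability.RandomPlanarGeometry

end
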